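import Summits.BirchSwinnertonDyer.BirchSwinnertonDyer.Theorems.PrintX10bHowardContainmentAnyClassNumberX10bThm413Hyp
import Literature.NumberTheory.EllipticCurves.HeegnerEnvelopeCoherentPairProofs
import Literature.NumberTheory.EllipticCurves.HeegnerGeomCoherentDataOfFrameProofs
import HarnessLib

/-!
# The MODULE-LEVEL Heegner envelope on odd-`d_K` X10b Heegner frames (p = 3), ANY class number:
# the X10b instance of the cell's frame-generic coherent-pair engine (helper for the A-side deciding crux
# `PrintX10b.HowardContainmentAnyClassNumberX10b[Pinned]OfPrint`, stmt-BirchSwinnertonDyer-23729 / 26623 / rev-27 re-type)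

Summits-side helper (seat `bsd-line-x10b-p2`, LEAD). THEOREMS ONLY (no definition, no named fact, no `sorry`);
closes nothing by itself; no summit statement is proved; BSD is not proved by any of this.

WHAT. `X10.envelopeModules_of_towerSharp` — on a non-CM X10b pair (`ClassX10 W p`: `p = 3` good ordinary,
`E[3]` irreducible), `K` imaginary quadratic with `d_K` odd and `≠ -3`, Heegner for `N_E` and for `3`, the
anticyclotomic datum `(κ, γ)` with the SHARPENED tower `K_k ⊆ K[3^{k+1}]` at the given `jbar`, a parametrisation
datum `Dt`, an oriented Heegner datum `H`, and ANY `Λ`-adic Selmer datum `D`: there are a CGLS `d(k)`-shifted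
stabilised datum `C` and a Heegner family `F`, BOTH on the frame's `(Dt, H.β)` (one principal CM system), and
`g ≠ 0` in `Λ` with the two MODULE inclusions `(3^e) • ℋ_F ≤ Λκ_∞(C)` (with `e = 0`) and `g • Λκ_∞(C) ≤ ℋ_F`.
This is EXACTLY the letter of the registered envelope stub of the pinned A-side skeletons (x9-p1 LEAD's
`Stmt.envelopeModulesSharp` on PrintX9's crux 27077; its X10b twin in x10b-p2's rev-27 skeleton), instantiated
from the frame-generic engine `exists_coherent_pair_envelope` (x9-p2, p621134; universal norms give `e = 0`)
with `#Gal(K[3]/K[1]) = 2` from `card_ringClassGalOver_prime_one_of_frame` (x9-p1, split prime of a frame) and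
(h1) `E(K)[3] = 0` from `X10.thm413Hypotheses_of_classX10` (p606553). NO characteristic ideal, NO torsion claim,
NO print fact is used: CM theory (Heegner points, ring class fields) and Kummer theory only.

References: F. Castella, G. Grossi, J. Lee, C. Skinner, Invent. Math. 227 (2022), §4.1 (the `d(k)`-shift) and
Rem. 4.1.4 («`κ_∞` and `κ₁^{Hg}` generate the same `Λ`-submodule»); B. Howard, Compositio 140 (2004), §3.3,
Thm. 3.3.7; B. Perrin-Riou, Bull. SMF 115 (1987), §3.2–3.4.
-/

set_option linter.dupNamespace false
set_option autoImplicit false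

noncomputable section

open scoped Classical Pointwise

namespace Summit.BirchSwinnertonDyer.BirchSwinnertonDyer.Rank1Residual

open WeierstrassCurve NumberField Literature.NumberTheory.EllipticCurves
  Literature.NumberTheory.EllipticCurves.ModularForms
  Literature.NumberTheory.EllipticCurves.CastellaGrossiLeeSkinner2022
open Literature.NumberTheory.EllipticCurves.Rank1Residual (ClassX10 Surj)

/-- **The module-level Heegner envelope on an odd-`d_K` X10b Heegner frame, any class number** (the X10b
instance of `exists_coherent_pair_envelope`): given the sharpened tower `K_k ⊆ K[p^{k+1}]` at `jbar`, for every
`Λ`-adic Selmer datum `D` there are a stabilised datum `C` and a Heegner family `F` on the frame's `(Dt, H.β)`,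
an exponent `e` (here `0`) and `g ≠ 0` with `(p^e) • ℋ_F ≤ Λκ_∞(C)` and `g • Λκ_∞(C) ≤ ℋ_F` — conjuncts in the
order of the registered stub letter `Stmt.envelopeModulesSharp` (`C.Dt = Dt ∧ F.Dt = Dt ∧ g ≠ 0 ∧ … ∧ …`).
[cite: CastellaGrossiLeeSkinner2022, §4.1 (Thm. 4.1.1 proof, d(k)) and Rem. 4.1.4] [cite: Howard2004HeegnerKolyvagin, §3.3, Thm. 3.3.7]
[cite: PerrinRiou1987BSMF, §3.4 Prop. 10] -/
theorem X10.envelopeModules_of_towerSharp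
    {W : WeierstrassCurve ℚ} [W.IsElliptic] [W.IsGloballyMinimal] [NeZero (W.conductorNorm ℤ)]
    {p : ℕ} [Fact p.Prime] {K : Type} [Field K] [NumberField K]
    (hX : ClassX10 W p) (hK : IsImaginaryQuadratic K) (hodd : Odd (NumberField.discr K))
    (h3 : NumberField.discr K ≠ -3)
    (hHN : SatisfiesHeegnerHypothesis (W.conductorNorm ℤ) K) (hHp : SatisfiesHeegnerHypothesis p K)
    {κ : ZpExtension K p} (hκ : κ.IsAnticyclotomic) {γ : Field.absoluteGaloisGroup K} (hγ : κ.IsTopGenerator γ)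
    (Dt : ModularParametrizationData W (W.conductorNorm ℤ))
    (H : HeegnerDatum (W.conductorNorm ℤ) (NumberField.discr K)) (jbar : AlgebraicClosure K →+* ℂ)
    (hTw1 : ∀ k : ℕ, ringClassSubgroup K (p ^ (k + 1)) jbar ≤ κ.layerSubgroup k)
    (D : (W.baseChange K).LambdaAdicSelmerData κ γ) :
    ∃ (C : StabilizedHeegnerData (W.conductorNorm ℤ) W K κ jbar)
      (F : HeegnerFamily (W.conductorNorm ℤ) W K κ jbar) (e : ℕ) (g : IwasawaAlgebra p),
      C.Dt = Dt ∧ F.Dt = Dt ∧ g ≠ 0 ∧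
      ((p : IwasawaAlgebra p) ^ e) • heegnerModule D F ≤ stabilizedHeegnerModule D C ∧
      g • stabilizedHeegnerModule D C ≤ heegnerModule D F := by
  have hp : p.Prime := Fact.out
  have hyp := X10.thm413Hypotheses_of_classX10 hX hK h3 hHN hHp hodd hκ hγ
  obtain ⟨C, F, hC, hF, -, -, hfwd, g, hg, hrev⟩ :=
    exists_coherent_pair_envelope hK hHN Dt H.dvd_sq_sub jbar hyp.ordinary hX.not_dvd_conductorNorm κ hγ hTw1
      (card_ringClassGalOver_prime_one_of_frame hK hodd h3 hp hHp jbar) hyp.noPTorsion D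
  exact ⟨C, F, 0, g, hC, hF, hg, by rwa [pow_zero, one_smul], hrev⟩

/-- **The same envelope with the orientation exposed** (`C.β = H.β ∧ F.β = H.β`) and the forward inclusion
stated SHARPLY (`ℋ_F ≤ Λκ_∞(C)`, no power of `p`): the raw output of the engine on the X10b frame, for
consumers that want the tie to `H` as well. [cite: CastellaGrossiLeeSkinner2022, Rem. 4.1.4]
[cite: Howard2004HeegnerKolyvagin, Thm. 3.3.7] -/
theorem X10.envelopeModulesSharp_of_towerSharp
    {W : WeierstrassCurve ℚ} [W.IsElliptic] [W.IsGloballyMinimal] [NeZero (W.conductorNorm ℤ)]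
    {p : ℕ} [Fact p.Prime] {K : Type} [Field K] [NumberField K]
    (hX : ClassX10 W p) (hK : IsImaginaryQuadratic K) (hodd : Odd (NumberField.discr K))
    (h3 : NumberField.discr K ≠ -3)
    (hHN : SatisfiesHeegnerHypothesis (W.conductorNorm ℤ) K) (hHp : SatisfiesHeegnerHypothesis p K)
    {κ : ZpExtension K p} (hκ : κ.IsAnticyclotomic) {γ : Field.absoluteGaloisGroup K} (hγ : κ.IsTopGenerator γ)
    (Dt : ModularParametrizationData W (W.conductorNorm ℤ))
    (H : HeegnerDatum (W.conductorNorm ℤ) (NumberField.discr K)) (jbar : AlgebraicClosure K →+* ℂ)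
    (hTw1 : ∀ k : ℕ, ringClassSubgroup K (p ^ (k + 1)) jbar ≤ κ.layerSubgroup k)
    (D : (W.baseChange K).LambdaAdicSelmerData κ γ) :
    ∃ (C : StabilizedHeegnerData (W.conductorNorm ℤ) W K κ jbar)
      (F : HeegnerFamily (W.conductorNorm ℤ) W K κ jbar),
      C.Dt = Dt ∧ F.Dt = Dt ∧ C.β = H.β ∧ F.β = H.β ∧
      heegnerModule D F ≤ stabilizedHeegnerModule D C ∧
      ∃ g : IwasawaAlgebra p, g ≠ 0 ∧ g • stabilizedHeegnerModule D C ≤ heegnerModule D F := by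
  have hp : p.Prime := Fact.out
  have hyp := X10.thm413Hypotheses_of_classX10 hX hK h3 hHN hHp hodd hκ hγ
  exact exists_coherent_pair_envelope hK hHN Dt H.dvd_sq_sub jbar hyp.ordinary hX.not_dvd_conductorNorm κ hγ hTw1
    (card_ringClassGalOver_prime_one_of_frame hK hodd h3 hp hHp jbar) hyp.noPTorsion D

end Summit.BirchSwinnertonDyer.BirchSwinnertonDyer.Rank1Residual

end
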